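import Summits.BirchSwinnertonDyer.Rank1Residual.X12.MillerStollRecords
import Summits.BirchSwinnertonDyer.Rank1Residual.X12.CMRamifiedAdditive
import Summits.BirchSwinnertonDyer.Rank1Residual.Partition.CornersCM
import Literature.NumberTheory.EllipticCurves.Rank1Residual.X12CubeSumTransport
import Literature.NumberTheory.EllipticCurves.Rank1Residual.Typed.KimCertificate
import Literature.NumberTheory.EllipticCurves.ComplexMultiplicationHasCMProofs
import HarnessLib

/-!
# K12r@3 — the `j = 0` block of the CM corner at the RAMIFIED prime `3`: leaf membership and the
# booking shape of the two-engine `3`-isogeny-descent certificate (cell `bsd-print-cfram`, seat p4)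

HONEST FRAMING (cell `bsd-print-cfram`, run/shared/lean/pub/bsd-print-cfram/, D-0131 (2) print
tier; verbatim in every file of the seat): the cell works the partition leaf
`CornerF ∧ p ramified in the CM field K` (LADDER-BSD row K7r = B13; W-ALL row 12r) in PARTITION
currency — a leaf or a cell counts only when its theorem is in the kernel BY NAME. This file is
BOOKKEEPING for the `p = 3` slice `Summit.BirchSwinnertonDyer.WAllCornerFRamifiedAtThree`
(`WAll/TargetCMRamifiedSlices.lean`): CM by an order of `ℚ(√−3)` (the only CM field of a curve over
`ℚ` in which `3` ramifies; `j ∈ {0, 54000, −12288000}`, every isogeny class has a `j = 0` member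
`E_k : y² = x³ + k`), `ord_{s=1} L(E, s) = 1`. NO class-wide theorem for this slice is in print
(bsd-wall-cm K12R3-SCOPING-v1 §3: Rubin 1991 excludes `p ∣ #𝓞_K^×`, BKNO 2026 needs `p ≥ 5`,
Heegner/BDP Kolyvagin systems die at the additive prime `3` with `E[3]` reducible); what exists is
a PER-CLASS certificate: the `3`-isogeny descent along `φ : E_k → E_{−27k}` (kernel `⟨(0, ±√k)⟩`),
run by TWO independent engines of two seats (x1b `x12sel3.gp`, kit j101548 / j101531; sha-2
`iso3kum.gp`, kit j103487 / j103505 via harvest-1) on all 919 classes with `N < 5·10⁵`: on 917 of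
them `dim Sel^φ + dim Sel^φ̂ = dim coker` ("EXCESS 0"), i.e. `Ш(E_k)[3] = 0`; the two exceptions
`309123c/d` are exactly the classes with `3 ∣ #Ш_an`. Nothing here is a Literature statement; no
named fact is introduced; every theorem is a composition of tree theorems BY NAME. The certificate
enters as the HYPOTHESIS `h0 : ∀ x ∈ Ш(E/ℚ), 3·x = 0 → x = 0`, the lane's exact analytic order as
`hq`/`hv` — exactly the binders of the booked seam `X12.bsdp_of_sha_torsion_eq_zero`
(`X12/MillerStollRecords.lean`, p220351). beyond-print: NO (certificate assembly).

## Contents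

* §1 LEAF MEMBERSHIP from `j = 0` alone: `cmFieldDiscrOfJ_eq_of_j_eq_zero` (`d_K = −3`),
  `cmRamified_three_of_j_eq_zero`, `not_cmSplit_three_of_j_eq_zero` (CM itself is the tree's
  `hasCM_of_j_eq_zero`), whence with `r_an = 1`: `classX12_three_of_j_eq_zero`,
  `cornerF_three_of_j_eq_zero` (bad at `3`: `X12.not_good_of_cmRamified`) — a `j = 0` curve of
  analytic rank one IS a cell of the leaf `CornerF ∧ CMRamified` at `p = 3`, by name.
* §2 THE CERTIFICATE SEAM AT `3` WITH THE EXACT ORDER: `card_primaryComponent_eq_one_of_noTorsion`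
  (`Ш[p] = 0 ⟹ #Ш[p^∞] = 1`, any prime, any curve) and its converse (tree
  `noPTorsion_of_card_primaryComponent_eq_one`), `bsdp_three_of_noThreeTorsion` =
  `BSD(E, 3) ∧ #Ш(E/ℚ)[3^∞] = 1` from `h0`, `r_an ≤ 1`, `#Ш_an = q` with `ord₃ q = 0` (GZK `hGZK`).
* §3 THE CLASS FORM (Cassels): `bsdp_three_of_isIsogenous_of_noThreeTorsion` — the same certificate
  on ONE globally minimal member gives `r_an = 1 ∧ BSD(·, 3)` on EVERY globally minimal curve
  `ℚ`-isogenous to it (tree `X12CubeSum.bsdp_three_of_isIsogenous`: Cassels `hCassels`, modularity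
  `hmod`).

The per-class records `bsdp_three_<label>` of the window `N < 2·10⁴` (files
`X12/JZeroThreeRecords*.lean` of this seat) instantiate §2/§3.

References: `WAll/TargetCMRamifiedSlices.lean` (the leaf); `Partition/CornersCM.lean` (`CornerF`);
`X12/CMRamifiedAdditive.lean`; `X12/MillerStollRecords.lean` §1; HOME/bsd-wall-cm/K12R3-SCOPING-v1.md;
x1b `X12-ROUTE.md` §17; [cite: Miller2011LMS, §1 and Def. 1.1]; [cite: MilneADT2006, Thm. I.7.3];
[cite: SilvermanAEC2009, X.4 (descent via isogeny)].
-/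

set_option autoImplicit false

noncomputable section

open scoped Classical

open WeierstrassCurve Literature.NumberTheory.EllipticCurves
  Literature.NumberTheory.EllipticCurves.ModularForms
  Literature.NumberTheory.EllipticCurves.Rank1Residual
  Literature.NumberTheory.EllipticCurves.Rank1Residual.Typed

namespace Summit.BirchSwinnertonDyer.Rank1Residual.X12.JZeroThree

/-! ## §1 Leaf membership from `j = 0` -/

section Leaf

variable (W : WeierstrassCurve ℚ) [W.IsElliptic]

/-- A `j = 0` curve has CM field `ℚ(√−3)`: `d_K = −3` (table `cmFieldDiscrOfJ`).
[cite: SilvermanATAEC1994, App. A §3 (table of CM j-invariants)] -/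
theorem cmFieldDiscrOfJ_eq_of_j_eq_zero (hj : W.j = 0) : cmFieldDiscrOfJ W.j = -3 := by
  simp [cmFieldDiscrOfJ, hj]

/-- `3` is RAMIFIED in the CM field of a `j = 0` curve (`3 ∣ d_K = −3`). [folklore] -/
theorem cmRamified_three_of_j_eq_zero (hj : W.j = 0) : CMRamified W 3 := by
  rw [CMRamified, cmFieldDiscrOfJ_eq_of_j_eq_zero W hj]
  norm_num

/-- `3` is NOT split in the CM field of a `j = 0` curve. [folklore] -/
theorem not_cmSplit_three_of_j_eq_zero (hj : W.j = 0) : ¬ CMSplit W 3 :=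
  fun h ↦ h.1 (cmRamified_three_of_j_eq_zero W hj)

/-- **A `j = 0` curve of analytic rank one is an X12 pair at `3`** (`cm ∧ r = 1 ∧ 3 ramified`).
[folklore] -/
theorem classX12_three_of_j_eq_zero (hj : W.j = 0) (hr : W.analyticRank = 1) : ClassX12 W 3 :=
  ⟨W.hasCM_of_j_eq_zero hj, hr, Or.inr (Or.inr (Or.inl (cmRamified_three_of_j_eq_zero W hj)))⟩

/-- A `j = 0` curve is BAD at `3` (CM, `3` odd and ramified: `X12.not_good_of_cmRamified`).
[folklore] -/
theorem not_good_three_of_j_eq_zero (hj : W.j = 0) : ¬ Good W 3 :=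
  X12.not_good_of_cmRamified W 3 (W.hasCM_of_j_eq_zero hj) (by norm_num)
    (cmRamified_three_of_j_eq_zero W hj)

/-- **A `j = 0` curve of analytic rank one lies in the CM corner `CornerF` at `p = 3`**
(`Partition/CornersCM.lean`: CM, `r = 1`, `3` bad and not split) — i.e. `(E, 3)` is a cell of the
leaf `CornerF ∧ CMRamified` = W-ALL row 12r at `3`. [folklore] -/
theorem cornerF_three_of_j_eq_zero (hj : W.j = 0) (hr : W.analyticRank = 1) : CornerF W 3 :=
  ⟨W.hasCM_of_j_eq_zero hj, hr,
    Or.inr ⟨not_cmSplit_three_of_j_eq_zero W hj, not_good_three_of_j_eq_zero W hj⟩⟩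

/-- The leaf's hypotheses at a `j = 0` curve of analytic rank one, bundled:
`HasCM ∧ analyticRank = 1 ∧ CMRamified W 3` (the binders of `WAllCornerFRamifiedAtThree`).
[folklore] -/
theorem leaf_hypotheses_of_j_eq_zero (hj : W.j = 0) (hr : W.analyticRank = 1) :
    W.HasCM ∧ W.analyticRank = 1 ∧ CMRamified W 3 :=
  ⟨W.hasCM_of_j_eq_zero hj, hr, cmRamified_three_of_j_eq_zero W hj⟩

end Leaf

/-! ## §2 The certificate seam at `3`, with the exact order of `Ш[3^∞]` -/

section Seam

variable (W : WeierstrassCurve ℚ) [W.IsElliptic]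

omit [W.IsElliptic] in
/-- **`Ш[p] = 0 ⟹ Ш[p^∞] = 0`**: if no non-zero element of `Ш(E/ℚ)` is killed by `p`, the
`p`-primary component is trivial (an element killed by `p^{n+1}` has `p^n · x` killed by `p`;
induct). Any prime, any curve; no finiteness needed. [folklore] -/
theorem card_primaryComponent_eq_one_of_noTorsion (p : ℕ)
    (h0 : ∀ x : ↥W.sha, p • x = 0 → x = 0) :
    Nat.card (AddCommGroup.primaryComponent W.sha p) = 1 := by
  have hkill : ∀ n : ℕ, ∀ x : ↥W.sha, p ^ n • x = 0 → x = 0 := by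
    intro n
    induction n with
    | zero => intro x hx; simpa using hx
    | succ n ih =>
      intro x hx
      refine ih x (h0 _ ?_)
      rw [← mul_smul, ← pow_succ']
      exact hx
  have hbot : ∀ x : ↥W.sha, x ∈ AddCommGroup.primaryComponent W.sha p → x = 0 := by
    intro x hx
    obtain ⟨n, hn⟩ := (AddCommGroup.mem_primaryComponent).mp hx
    exact hkill n x hn
  haveI : Subsingleton ↥(AddCommGroup.primaryComponent W.sha p) :=
    ⟨fun a b ↦ Subtype.ext ((hbot a.1 a.2).trans (hbot b.1 b.2).symm)⟩
  exact Nat.card_of_subsingleton (0 : ↥(AddCommGroup.primaryComponent W.sha p))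

omit [W.IsElliptic] in
/-- Conversely `#Ш[p^∞] = 1 ⟹ Ш[p] = 0` (tree `noPTorsion_of_card_primaryComponent_eq_one`, in
`ℕ`-scalar form). [folklore] -/
theorem noTorsion_of_card_primaryComponent_eq_one (p : ℕ)
    (h : Nat.card (AddCommGroup.primaryComponent W.sha p) = 1) :
    ∀ x : ↥W.sha, p • x = 0 → x = 0 := fun x hx ↦
  noPTorsion_of_card_primaryComponent_eq_one W p h x (by rwa [natCast_zsmul])

/-- **The booking shape of the `3`-descent certificate, with the exact order.** For an elliptic
`W/ℚ` with `ord_{s=1} L(E,s) ≤ 1`, the certificate `Ш(E/ℚ)[3] = 0` (`h0`; here: two-engine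
`3`-isogeny descent, EXCESS 0) and the lane's `#Ш_an = q` with `ord₃ q = 0` give Miller's
`BSD(E, 3)` (tree seam `X12.bsdp_of_sha_torsion_eq_zero`, GZK `hGZK`) AND `#Ш(E/ℚ)[3^∞] = 1`.
PER CLASS; the class-wide statement at `3` is not in print. [cite: Miller2011LMS, §1 and Def. 1.1] -/
theorem bsdp_three_of_noThreeTorsion (hGZK : rank_eq_analyticRank_of_analyticRank_le_one)
    (hr : W.analyticRank ≤ 1) (h0 : ∀ x : ↥W.sha, 3 • x = 0 → x = 0)
    {q : ℚ} (hq : shaAn W = (q : ℂ)) (hv : padicValRat 3 q = 0) :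
    BSDp W 3 ∧ Nat.card (AddCommGroup.primaryComponent W.sha 3) = 1 :=
  haveI : Fact (Nat.Prime 3) := ⟨Nat.prime_three⟩
  ⟨X12.bsdp_of_sha_torsion_eq_zero hGZK W 3 hr h0 hq hv,
    card_primaryComponent_eq_one_of_noTorsion W 3 h0⟩

/-- **Leaf-vocabulary form.** At a `j = 0` curve of analytic rank one — a cell of
`CornerF ∧ CMRamified` at `3` (`cornerF_three_of_j_eq_zero`) — the certificate `Ш[3] = 0` and
`ord₃ #Ш_an = 0` give `BSD(E, 3)`. [cite: Miller2011LMS, §1 and Def. 1.1] -/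
theorem bsdp_three_of_j_eq_zero_of_noThreeTorsion
    (hGZK : rank_eq_analyticRank_of_analyticRank_le_one)
    (hr : W.analyticRank = 1) (h0 : ∀ x : ↥W.sha, 3 • x = 0 → x = 0)
    {q : ℚ} (hq : shaAn W = (q : ℂ)) (hv : padicValRat 3 q = 0) : BSDp W 3 :=
  (bsdp_three_of_noThreeTorsion W hGZK hr.le h0 hq hv).1

end Seam

/-! ## §3 The class form (Cassels' isogeny invariance) -/

section ClassForm

/-- **One certificate closes the isogeny class.** If a globally minimal `W/ℚ` with
`ord_{s=1} L(E,s) = 1` carries the certificate `Ш(W/ℚ)[3] = 0` and `#Ш_an(W) = q`, `ord₃ q = 0`,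
then EVERY globally minimal `W'` that is `ℚ`-isogenous to `W` has `ord_{s=1} L = 1` and satisfies
`BSD(W', 3)` (Cassels' invariance of the BSD quotient `hCassels`, modularity `hmod`, GZK `hGZK`;
tree `X12CubeSum.bsdp_three_of_isIsogenous`). [cite: MilneADT2006, Thm. I.7.3]
[cite: Miller2011LMS, §1 and Def. 1.1] -/
theorem bsdp_three_of_isIsogenous_of_noThreeTorsion
    (hGZK : rank_eq_analyticRank_of_analyticRank_le_one) (hmod : hasEntireLFunction_rat)
    (hCassels : bsdRHS_eq_of_isIsogenous)
    {W : WeierstrassCurve ℚ} [W.IsElliptic] [W.IsGloballyMinimal]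
    (hr : W.analyticRank = 1) (h0 : ∀ x : ↥W.sha, 3 • x = 0 → x = 0)
    {q : ℚ} (hq : shaAn W = (q : ℂ)) (hv : padicValRat 3 q = 0)
    (W' : WeierstrassCurve ℚ) [W'.IsElliptic] [W'.IsGloballyMinimal] (hiso : IsIsogenous W' W) :
    W'.analyticRank = 1 ∧ BSDp W' 3 :=
  X12CubeSum.bsdp_three_of_isIsogenous hCassels hmod hiso hr (hGZK W hr.le).2
    (bsdp_three_of_j_eq_zero_of_noThreeTorsion W hGZK hr h0 hq hv)

end ClassForm

end Summit.BirchSwinnertonDyer.Rank1Residual.X12.JZeroThree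

end
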